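import Summits.ValiantsHypothesis.ValiantsHypothesis.Theorems.KPlusLogSqLawStaticPathSilentFlipsWindow

/-!
# Route «KPlusLogSqLaw» — parametric max-weight independent set on a path: CHAINS OF OPTIMA HAVE AT MOST n + #SILENT CROSSINGS STEPS

HONEST FRAMING.  Helper toward the crux `WeakLifting` (item `stmt-ValiantsHypothesis-19561`, route `KPlusLogSqLaw`, cell `pub-symmetroid`,
seat val-sym-lift-p4 g24, 2026-08-29) on the line of its witness-plan stub `stub_tridiagonalSectorB` (tropical twin of the STATIC tridiagonal
sector = parametric maximum-weight independent set on a path; located theory `HOME/val-sym-lift-p4/SILENT-FLIP-LAW.md`, THEOREM A).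
The consumable form of THEOREM A in the CHAIN currency of `…StaticPathChain.chain_le` (the kernel `O(n log n)` law) and
`…StaticPathSweepChain.chain_le_card_eventCrossings`: for the block `i+1, …, i+n` with pairwise distinct crossing abscissae of the non-parallel
prefix-sum pairs and parallel pairs distinct lines, every chain of optimal independent sets `M_0, …, M_N` at strictly increasing parameters with
pairwise distinct prefix-sum values at each sample and consecutive sets distinct satisfies

  `N ≤ n + #{silent crossings strictly between the first and the last parameter}`  (`chain_le_add_card_silentCrossings`),

a silent crossing being a crossing at which the record set changes (`…StaticPathSilentCrossings`: the tie-free test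
`(lab (q-1) τ = p ∧ q not a right record) ∨ (lab' (n-p-1) τ = n-q ∧ p not a left record)` at the crossing abscissa `τ`).  Immediate from
`chain_le_card_eventCrossings` and `card_eventCrossings_le_add_card_silentCrossings`.  Statements about a path DP; nothing here asserts anything
about `WeakLifting`, `TropicalB`, `KPlusLogSqLaw`, the stub in its window, `MatrixDescartes` (stmt-ValiantsHypothesis-18050) or `VP ≠ VNP`; the
ORDER QUESTION stays open.
-/

set_option linter.dupNamespace false
set_option autoImplicit false

namespace Summit.ValiantsHypothesis.ValiantsHypothesis.Theorems.KPlusLogSqLaw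

open Finset Classical

namespace StaticPathFold

noncomputable section

section Chain

variable (w₁ w₀ : ℕ → ℝ)

/-- **CHAINS OF OPTIMA ARE NO LONGER THAN n + THE NUMBER OF SILENT CROSSINGS THEY SPAN** (THEOREM A of
`HOME/val-sym-lift-p4/SILENT-FLIP-LAW.md` in the chain currency). [folklore] -/
theorem chain_le_add_card_silentCrossings (i n N : ℕ) (θs : Fin (N + 1) → ℝ) (hθ : StrictMono θs) (Ms : Fin (N + 1) → Finset ℕ)
    (hgen : ∀ p q p' q', p < q → q ≤ n → p' < q' → q' ≤ n → (p ≠ p' ∨ q ≠ q') →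
      altA (shift i w₁) p ≠ altA (shift i w₁) q → altA (shift i w₁) p' ≠ altA (shift i w₁) q' →
      (altB (shift i w₀) q - altB (shift i w₀) p) / (altA (shift i w₁) p - altA (shift i w₁) q) ≠
        (altB (shift i w₀) q' - altB (shift i w₀) p') / (altA (shift i w₁) p' - altA (shift i w₁) q'))
    (hpar : ∀ p q, p < q → q ≤ n → altA (shift i w₁) p = altA (shift i w₁) q → altB (shift i w₀) p ≠ altB (shift i w₀) q)
    (hmem : ∀ k, Ms k ∈ indepSets i n)
    (hopt : ∀ k, ∑ t ∈ Ms k, W w₁ w₀ t (θs k) = opt w₁ w₀ i n (θs k))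
    (hdis : ∀ k, ∀ p q, p ≤ n → q ≤ n → p ≠ q →
      L (altA (shift i w₁)) (altB (shift i w₀)) p (θs k) ≠ L (altA (shift i w₁)) (altB (shift i w₀)) q (θs k))
    (hch : ∀ e : Fin N, Ms e.castSucc ≠ Ms e.succ) :
    N ≤ n + (((range (n + 1)) ×ˢ (range (n + 1))).filter (fun pq : ℕ × ℕ => pq.1 < pq.2 ∧
        altA (shift i w₁) pq.1 ≠ altA (shift i w₁) pq.2 ∧
        θs 0 < (altB (shift i w₀) pq.2 - altB (shift i w₀) pq.1) / (altA (shift i w₁) pq.1 - altA (shift i w₁) pq.2) ∧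
        (altB (shift i w₀) pq.2 - altB (shift i w₀) pq.1) / (altA (shift i w₁) pq.1 - altA (shift i w₁) pq.2) < θs (Fin.last N) ∧
        ((lab (altA (shift i w₁)) (altB (shift i w₀)) (pq.2 - 1)
              ((altB (shift i w₀) pq.2 - altB (shift i w₀) pq.1) / (altA (shift i w₁) pq.1 - altA (shift i w₁) pq.2)) = pq.1 ∧
            ¬ fold (altA (shift 0 (rev i n w₁))) (altB (shift 0 (rev i n w₀))) (n - pq.2)
                ((altB (shift i w₀) pq.2 - altB (shift i w₀) pq.1) / (altA (shift i w₁) pq.1 - altA (shift i w₁) pq.2)) =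
              L (altA (shift 0 (rev i n w₁))) (altB (shift 0 (rev i n w₀))) (n - pq.2)
                ((altB (shift i w₀) pq.2 - altB (shift i w₀) pq.1) / (altA (shift i w₁) pq.1 - altA (shift i w₁) pq.2))) ∨
          (lab (altA (shift 0 (rev i n w₁))) (altB (shift 0 (rev i n w₀))) (n - pq.1 - 1)
              ((altB (shift i w₀) pq.2 - altB (shift i w₀) pq.1) / (altA (shift i w₁) pq.1 - altA (shift i w₁) pq.2)) = n - pq.2 ∧
            ¬ fold (altA (shift i w₁)) (altB (shift i w₀)) pq.1
                ((altB (shift i w₀) pq.2 - altB (shift i w₀) pq.1) / (altA (shift i w₁) pq.1 - altA (shift i w₁) pq.2)) =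
              L (altA (shift i w₁)) (altB (shift i w₀)) pq.1
                ((altB (shift i w₀) pq.2 - altB (shift i w₀) pq.1) / (altA (shift i w₁) pq.1 - altA (shift i w₁) pq.2)))))).card := by
  rcases Nat.eq_zero_or_pos N with hN | hN
  · subst hN; exact Nat.zero_le _
  have hlohi : θs 0 < θs (Fin.last N) := hθ (Fin.lt_def.mpr (by simp; omega))
  exact le_trans (chain_le_card_eventCrossings w₁ w₀ i n N θs hθ Ms hgen hmem hopt hdis hch)
    (card_eventCrossings_le_add_card_silentCrossings w₁ w₀ hlohi hgen hpar)

end Chain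

end

end StaticPathFold

end Summit.ValiantsHypothesis.ValiantsHypothesis.Theorems.KPlusLogSqLaw
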